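import Summits.MatrixMultiplication.OmegaCensus.SmallFormats.MatMul227GF3FootprintCert
import HarnessLib

/-!
# ω-census family (a): `⟨2,2,7⟩ @ 23` over `𝔽₃` — a kernel-fast Boolean form of the Rado-failure certificate check

Cell `pub-omega` (unit `pub-omega-tensor-g32`), topic `Summits/MatrixMultiplication/OmegaCensus` (sub-folder `SmallFormats`).
Framing (verbatim): lottery ticket; floor = certified bounds/negative ranges. HONEST FRAMING: bookkeeping. `CertOK`
(`MatMul227GF3FootprintCert`, p630055) is a conjunction of `𝔽₃` identities with `Finset` sums and `Fin`-quantifiers; replayed by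
`decide` it costs seconds per certificate and the kernel runs out of memory beyond a few dozen certificates in one call (measured,
tensor g32). `checkN` below states the same conditions with structural recursions (`sumNat`, `allN`) and natural-number arithmetic
reduced mod 3 only at the comparisons, skipping zero coefficients; `certOK_of_checkN` proves it implies `CertOK`, hence `RadoFails`
(`radoFails_of_checkN`); `forall_lt_of_blocks` turns block-wise checks into an index-wise statement. Measured on the farm: ≈ 0.35 s
per certificate. No certificate data here; nothing on `ω`.
-/

namespace Summit.MatrixMultiplication.OmegaCensus.SmallFormats

open Module Matrix Literature.Computability.AlgebraicComplexity RankOnePlaneCapGeneral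

/-! ## A kernel-fast checker in natural-number arithmetic -/

/-- Digit `p` of `n` in base 3, as a natural number (`trit n p` is its image in `𝔽₃`). -/
def tritN (n p : ℕ) : ℕ := n / 3 ^ p % 3

/-- `trit` is the cast of `tritN`. -/
theorem trit_eq_cast (n p : ℕ) : trit n p = ((tritN n p : ℕ) : ZMod 3) := rfl

/-- Structural sum `f 0 + ⋯ + f (n−1)` in `ℕ`. -/
def sumNat : ℕ → (ℕ → ℕ) → ℕ
  | 0, _ => 0
  | n + 1, f => sumNat n f + f n

/-- Structural conjunction `p 0 ∧ ⋯ ∧ p (n−1)`. -/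
def allN : ℕ → (ℕ → Bool) → Bool
  | 0, _ => true
  | n + 1, p => allN n p && p n

/-- The cast of `sumNat` is the sum over `Fin n` of the casts. -/
theorem cast_sumNat (n : ℕ) (f : ℕ → ℕ) : ((sumNat n f : ℕ) : ZMod 3) = ∑ i : Fin n, ((f i : ℕ) : ZMod 3) := by
  rw [Fin.sum_univ_eq_sum_range (fun i => ((f i : ℕ) : ZMod 3)) n]
  induction n with
  | zero => simp [sumNat]
  | succ n ih => rw [sumNat, Nat.cast_add, ih, Finset.sum_range_succ]

/-- `allN n p` holds iff `p i` for all `i < n`. -/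
theorem allN_eq_true {n : ℕ} {p : ℕ → Bool} : allN n p = true ↔ ∀ i < n, p i = true := by
  induction n with
  | zero => simp [allN]
  | succ n ih =>
      rw [allN, Bool.and_eq_true, ih]
      constructor
      · rintro ⟨h, hn⟩ i hi
        rcases Nat.lt_succ_iff_lt_or_eq.mp hi with h' | rfl
        · exact h i h'
        · exact hn
      · intro h
        exact ⟨fun i hi => h i (Nat.lt_succ_of_lt hi), h n (Nat.lt_succ_self n)⟩

/-- `fval` in `ℕ` (via `ZMod.val` of the entries). -/
def fvalN (U X : Matrix (Fin 2) (Fin 2) (ZMod 3)) : ℕ :=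
  (X 0 0).val * (U 0 0).val + (X 0 1).val * (U 0 1).val + (X 1 0).val * (U 1 0).val + (X 1 1).val * (U 1 1).val

/-- The cast of `fvalN` is `fval`. -/
theorem cast_fvalN (U X : Matrix (Fin 2) (Fin 2) (ZMod 3)) : ((fvalN U X : ℕ) : ZMod 3) = fval U X := by
  simp only [fvalN, fval, Nat.cast_add, Nat.cast_mul, ZMod.natCast_zmod_val]

/-- `if a = 0 then 0 else a * b = a * b` (lets the checker skip zero coefficients). -/
theorem ite_zero_mul (a b : ℕ) : (if a = 0 then 0 else a * b) = a * b := by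
  split_ifs with h
  · rw [h, zero_mul]
  · rfl

/-- `comb` in `ℕ`, skipping zero coefficients. -/
def combN (Ki ann : List ℕ) (cc : ℕ) (r' c : ℕ) : ℕ :=
  sumNat 3 fun a => sumNat 5 fun e =>
    if tritN cc (5 * a + e) = 0 then 0 else tritN cc (5 * a + e) *
      sumNat 2 fun r => tritN (Ki.getD a 0) (2 * r + r') * tritN (ann.getD e 0) (7 * r + c)

/-- The cast of `combN` is `comb`. -/
theorem cast_combN (Ki ann : List ℕ) (cc : ℕ) (r' : Fin 2) (c : Fin 7) :
    ((combN Ki ann cc r' c : ℕ) : ZMod 3) = comb Ki ann cc r' c := by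
  simp only [combN, comb, ite_zero_mul, cast_sumNat, Nat.cast_mul, trit_eq_cast]

/-- **Kernel-fast Boolean checker** with the content of `CertOK`: all loops are structural recursions and all arithmetic is in `ℕ`
(reduced mod 3 at the comparisons), so that `checkN … = true` is a cheap `decide +kernel`. -/
def checkN (m : Fin 23 → Matrix (Fin 2) (Fin 2) (ZMod 3)) (X₀ : Matrix (Fin 2) (Fin 2) (ZMod 3)) (K : List (List ℕ))
    (rows ann : List ℕ) (c : Cert) : Bool :=
  allN 5 (fun e => allN 9 fun s =>
    (sumNat 14 fun p => tritN (ann.getD e 0) p * tritN (rows.getD s 0) p) % 3 == 0) &&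
  allN 23 (fun i => !(c.Tmask.testBit i) || (if h : i < 23 then
      !(fvalN (m ⟨i, h⟩) X₀ % 3 == 0) &&
      allN 3 (fun a => fvalN (m ⟨i, h⟩) (decX ((K.getD i []).getD a 0)) % 3 == 0) &&
      allN c.H.length (fun ℓ => allN 2 fun r' => allN 7 fun cc =>
        tritN (c.H.getD ℓ 0) (7 * r' + cc) == combN (K.getD i []) ann ((c.C.getD ℓ []).getD i 0) r' cc % 3)
    else false)) &&
  allN c.H.length (fun ℓ => decide (c.piv.getD ℓ 0 < 14) &&
    allN c.H.length fun ℓ' => tritN (c.H.getD ℓ' 0) (c.piv.getD ℓ 0) == (if ℓ = ℓ' then 1 else 0)) &&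
  decide (14 < c.H.length + (tset c).card)

/-- `a % 3 = 0` in `ℕ` gives `(a : 𝔽₃) = 0`. -/
theorem cast_eq_zero_of_mod {a : ℕ} (h : a % 3 = 0) : (a : ZMod 3) = 0 := by
  rw [← ZMod.natCast_mod a 3, h, Nat.cast_zero]

/-- `tritN n p < 3`. -/
theorem tritN_lt (n p : ℕ) : tritN n p < 3 := Nat.mod_lt _ (by norm_num)

/-- **Soundness of the fast checker**: `checkN = true ⇒ CertOK`. -/
theorem certOK_of_checkN {m : Fin 23 → Matrix (Fin 2) (Fin 2) (ZMod 3)} {X₀ : Matrix (Fin 2) (Fin 2) (ZMod 3)}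
    {K : List (List ℕ)} {rows ann : List ℕ} {c : Cert} (h : checkN m X₀ K rows ann c = true) :
    CertOK m X₀ K rows ann c := by
  unfold checkN at h
  simp only [Bool.and_eq_true] at h
  obtain ⟨⟨⟨h1, h2⟩, h3⟩, h4⟩ := h
  refine ⟨?_, ?_, ?_, of_decide_eq_true h4⟩
  · intro e he s hs
    have h' := (allN_eq_true.mp ((allN_eq_true.mp h1) e he)) s hs
    rw [beq_iff_eq] at h'
    have h'' := cast_eq_zero_of_mod h'
    rw [cast_sumNat] at h''
    simp only [Nat.cast_mul, ← trit_eq_cast] at h''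
    exact h''
  · intro i hi
    have h' := (allN_eq_true.mp h2) i i.2
    rw [hi, Bool.not_true, Bool.false_or, dif_pos i.2, Bool.and_eq_true, Bool.and_eq_true] at h'
    obtain ⟨⟨ha, hb⟩, hc⟩ := h'
    refine ⟨?_, fun a ha' => ?_, fun ℓ hℓ r' cc => ?_⟩
    · -- `fval ≠ 0`
      intro h0
      rw [Bool.not_eq_true', beq_eq_false_iff_ne, ne_eq] at ha
      apply ha
      rw [← cast_fvalN] at h0
      exact Nat.mod_eq_zero_of_dvd ((ZMod.natCast_eq_zero_iff _ _).mp h0)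
    · have hb' := (allN_eq_true.mp hb) a ha'
      rw [beq_iff_eq] at hb'
      rw [← cast_fvalN]
      exact cast_eq_zero_of_mod hb'
    · have hc' := (allN_eq_true.mp ((allN_eq_true.mp ((allN_eq_true.mp hc) ℓ hℓ)) r' r'.2)) cc cc.2
      rw [beq_iff_eq] at hc'
      rw [trit_eq_cast, hc', ZMod.natCast_mod, cast_combN]
  · intro ℓ hℓ
    have h' := (allN_eq_true.mp h3) ℓ hℓ
    rw [Bool.and_eq_true] at h'
    refine ⟨of_decide_eq_true h'.1, fun ℓ' hℓ' => ?_⟩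
    have h'' := (allN_eq_true.mp h'.2) ℓ' hℓ'
    rw [beq_iff_eq] at h''
    rw [trit_eq_cast, h'']
    split_ifs <;> simp

/-- `RadoFails` from the fast checker. -/
theorem radoFails_of_checkN {m : Fin 23 → Matrix (Fin 2) (Fin 2) (ZMod 3)} {X₀ : Matrix (Fin 2) (Fin 2) (ZMod 3)}
    {K : List (List ℕ)} {rows ann : List ℕ} {c : Cert} (h : checkN m X₀ K rows ann c = true) :
    RadoFails m X₀ (decB rows) :=
  radoFails_of_certOK (certOK_of_checkN h)

/-- Blocks of `B` consecutive checks cover every index below `B·G`. -/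
theorem forall_lt_of_blocks {B G : ℕ} {f : ℕ → Bool} (h : ∀ g < G, allN B (fun t => f (B * g + t)) = true) :
    ∀ idx < B * G, f idx = true := by
  intro idx hidx
  have hB : 0 < B := Nat.pos_of_ne_zero fun hB => by rw [hB, Nat.zero_mul] at hidx; exact Nat.not_lt_zero _ hidx
  have hg : idx / B < G := Nat.div_lt_of_lt_mul hidx
  have h' := (allN_eq_true.mp (h _ hg)) (idx % B) (Nat.mod_lt _ hB)
  rwa [Nat.div_add_mod] at h'


end Summit.MatrixMultiplication.OmegaCensus.SmallFormats
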